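import Summits.Ventures.HodgeRepro.BallGenLemmaW

/-!
# Lemma W for holomorphic fields, every `p`: the translated covectors are independent on a dense open set (seat p5)

Blind re-derivation cell `pub-hodge-repro`, seat `p5` (second seat on statement (c)).  Built on typer-2's general
ball model `HodgeRepro.BallGen` (`U(p,1)` on `𝔹^p`, `act`, `Jac`, `pullback`, `lemmaW_iter`).  Nothing here says
anything about the status of the Hodge conjecture for CM abelian varieties, which is NOT proved.

`lemmaW_iter` (typer-2) gives, for a dense `Δ ≤ U(p,1)` and `p` continuous fields `ω₁, …, ω_p` that are not
identically zero, translates `γ_j ∈ Δ` and ONE point `z` at which `(γ₁^*ω₁)(z), …, (γ_p^*ω_p)(z)` are linearly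
independent.  ROUTE.md Appendix A4 / Route C R5 use this for HOLOMORPHIC fields and need the independence
"generically".  This file supplies that step, for fields that are restrictions of `ℂ`-analytic maps `ℂ^p → ℂ^p`
on the open ball `ballSet p = {z | nsq z < 1}`, following `BallHolo.lean` (the `p = 2` case on the sealed model):

* `ballSet p` is open, star-shaped about `0`, hence preconnected;
* `actE`, `JacE`, `pullE` are `ℂ`-analytic on the ball (rational in `z`, denominator `(γ·(z,1))_last ≠ 0`);
* `detE γ ω z = det ((γ_i^*ω_i)(z))_{i,j}` is analytic on the ball, and the translated covectors are linearly
  independent at `z` iff `detE γ ω z ≠ 0` (`linearIndependent_iff_detE_ne_zero`);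
* `dense_linearIndependent_of_analyticOnNhd` — independence at ONE point gives independence on a DENSE set
  (identity principle on the connected ball); `isOpen_linearIndependent` — that set is open;
* `lemmaW_generic` — for a dense `Δ` and analytic `ω₁, …, ω_p ≢ 0`: some `γ_j ∈ Δ` make
  `{z | (γ_j^*ω_j)(z) linearly independent}` open and dense in `𝔹^p`.
-/

set_option autoImplicit false

noncomputable section

namespace HodgeRepro.BallGen

namespace Holo

open Matrix

variable {p : ℕ}

/-! ### The open ball as a subset of `ℂ^p` -/

/-- The open unit ball `{z ∈ ℂ^p : Σ|z_i|² < 1}` as a subset of `ℂ^p` (the carrier of `Ball p`). -/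
def ballSet (p : ℕ) : Set (Fin p → ℂ) := {z | nsq z < 1}

/-- Membership in `ballSet`. -/
theorem mem_ballSet {z : Fin p → ℂ} : z ∈ ballSet p ↔ nsq z < 1 := Iff.rfl

/-- Points of `Ball p` lie in `ballSet p`. -/
theorem val_mem_ballSet (z : Ball p) : z.1 ∈ ballSet p := z.2

/-- `nsq` is continuous. -/
theorem continuous_nsq : Continuous (nsq : (Fin p → ℂ) → ℝ) := by
  unfold nsq
  fun_prop

/-- `ballSet p` is open. -/
theorem isOpen_ballSet : IsOpen (ballSet p) := isOpen_lt continuous_nsq continuous_const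

/-- `nsq (t • z) = t² nsq z` for real `t`. -/
theorem nsq_smul (t : ℝ) (z : Fin p → ℂ) : nsq (t • z) = t ^ 2 * nsq z := by
  simp only [nsq, Pi.smul_apply, norm_smul, Real.norm_eq_abs, mul_pow, sq_abs, Finset.mul_sum]

/-- `nsq z ≥ 0`. -/
theorem nsq_nonneg (z : Fin p → ℂ) : 0 ≤ nsq z := Finset.sum_nonneg fun i _ => by positivity

/-- `ballSet p` is star-shaped about the origin. -/
theorem starConvex_ballSet : StarConvex ℝ 0 (ballSet p) := by
  intro z hz a b ha hb hab
  rw [smul_zero, zero_add, mem_ballSet, nsq_smul]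
  have hz' : nsq z < 1 := hz
  have hn : 0 ≤ nsq z := nsq_nonneg z
  have hb1 : b ≤ 1 := by linarith
  have hb2 : b ^ 2 ≤ 1 := by nlinarith
  nlinarith

/-- The origin lies in `ballSet p`. -/
theorem zero_mem_ballSet : (0 : Fin p → ℂ) ∈ ballSet p := by
  rw [mem_ballSet]; simp [nsq]

/-- `ballSet p` is preconnected. -/
theorem isPreconnected_ballSet : IsPreconnected (ballSet p) :=
  (starConvex_ballSet.isPathConnected zero_mem_ballSet).isConnected.isPreconnected

/-! ### The action, the Jacobian and the translate as functions on `ℂ^p` -/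

/-- The lift `z ↦ (z, 1)` on `ℂ^p`. -/
def liftE (z : Fin p → ℂ) : Idx p → ℂ := Sum.elim z fun _ => 1

/-- `γ · (z, 1)` on `ℂ^p`. -/
def WE (g : U p) (z : Fin p → ℂ) : Idx p → ℂ := mat g *ᵥ liftE z

/-- The fractional-linear action on `ℂ^p` (where the denominator does not vanish). -/
def actE (g : U p) (z : Fin p → ℂ) : Fin p → ℂ := fun i => WE g z (Sum.inl i) / WE g z (last p)

/-- The Jacobian on `ℂ^p`. -/
def JacE (g : U p) (z : Fin p → ℂ) : Matrix (Fin p) (Fin p) ℂ :=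
  Matrix.of fun i j => (mat g (Sum.inl i) (Sum.inl j) * WE g z (last p) -
    WE g z (Sum.inl i) * mat g (last p) (Sum.inl j)) / WE g z (last p) ^ 2

/-- The translate `(γ^*F)(z) = J_γ(z)ᵀ F(γ z)` on `ℂ^p`, for a field `F : ℂ^p → ℂ^p`. -/
def pullE (γ : U p) (F : (Fin p → ℂ) → (Fin p → ℂ)) (z : Fin p → ℂ) : Fin p → ℂ :=
  (JacE γ z)ᵀ *ᵥ F (actE γ z)

/-- On the ball, `W` is `WE`. -/
theorem W_eq_WE (g : U p) (z : Ball p) : W g z = WE g z.1 := rfl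

/-- On the ball, the coordinates of `act g z` are `actE g z.1`. -/
theorem act_val_eq_actE (g : U p) (z : Ball p) : (act g z).1 = actE g z.1 := rfl

/-- On the ball, `Jac` is `JacE`. -/
theorem Jac_eq_JacE (g : U p) (z : Ball p) : Jac g z = JacE g z.1 := rfl

/-- On the ball, the translate of the restriction of `F` is `pullE`. -/
theorem pullback_eq_pullE (γ : U p) (F : (Fin p → ℂ) → (Fin p → ℂ)) (z : Ball p) :
    pullback γ (fun w : Ball p => F w.1) z = pullE γ F z.1 := rfl

/-- The denominator `(γ·(z,1))_last` does not vanish on the ball. -/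
theorem WE_last_ne_zero (g : U p) {z : Fin p → ℂ} (hz : z ∈ ballSet p) : WE g z (last p) ≠ 0 :=
  W_last_ne_zero g ⟨z, hz⟩

/-- `actE g z` lies in the ball for `z` in the ball. -/
theorem actE_mem_ballSet (g : U p) {z : Fin p → ℂ} (hz : z ∈ ballSet p) : actE g z ∈ ballSet p :=
  (act g ⟨z, hz⟩).2

/-- The entries of `γ·(z,1)` are affine in `z`. -/
theorem WE_apply (g : U p) (z : Fin p → ℂ) (j : Idx p) :
    WE g z j = ∑ i, mat g j (Sum.inl i) * z i + mat g j (last p) := by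
  simp [WE, liftE, Matrix.mulVec, dotProduct, Fintype.sum_sum_type, last]

/-! ### Analyticity -/

/-- The coordinate functions of `ℂ^p` are analytic. -/
@[fun_prop]
theorem analyticAt_coord (i : Fin p) (z : Fin p → ℂ) : AnalyticAt ℂ (fun z : Fin p → ℂ => z i) z :=
  (ContinuousLinearMap.proj (R := ℂ) (φ := fun _ : Fin p => ℂ) i).analyticAt z

/-- The entries of `γ·(z,1)` are analytic (entire). -/
theorem analyticAt_WE (g : U p) (j : Idx p) (z : Fin p → ℂ) : AnalyticAt ℂ (fun z => WE g z j) z := by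
  have h : (fun z : Fin p → ℂ => WE g z j) = fun z => ∑ i, mat g j (Sum.inl i) * z i + mat g j (last p) :=
    funext fun z => WE_apply g z j
  rw [h]
  fun_prop

/-- The coordinates of the action are analytic on the ball. -/
theorem analyticAt_actE (g : U p) (i : Fin p) {z : Fin p → ℂ} (hz : z ∈ ballSet p) :
    AnalyticAt ℂ (fun z => actE g z i) z :=
  (analyticAt_WE g (Sum.inl i) z).fun_div (analyticAt_WE g (last p) z) (WE_last_ne_zero g hz)

/-- The action `z ↦ actE g z` is analytic on the ball (as a map into `ℂ^p`). -/
theorem analyticAt_actE_fun (g : U p) {z : Fin p → ℂ} (hz : z ∈ ballSet p) : AnalyticAt ℂ (actE g) z :=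
  AnalyticAt.pi fun i => analyticAt_actE g i hz

/-- The entries of the Jacobian are analytic on the ball. -/
theorem analyticAt_JacE (g : U p) (i j : Fin p) {z : Fin p → ℂ} (hz : z ∈ ballSet p) :
    AnalyticAt ℂ (fun z => JacE g z i j) z := by
  have hne : WE g z (last p) ^ 2 ≠ 0 := pow_ne_zero 2 (WE_last_ne_zero g hz)
  show AnalyticAt ℂ (fun z => (mat g (Sum.inl i) (Sum.inl j) * WE g z (last p) -
    WE g z (Sum.inl i) * mat g (last p) (Sum.inl j)) / WE g z (last p) ^ 2) z
  have h1 := analyticAt_WE g (last p) z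
  have h2 := analyticAt_WE g (Sum.inl i) z
  exact ((analyticAt_const.fun_mul h1).fun_sub (h2.fun_mul analyticAt_const)).fun_div (h1.fun_pow 2) hne

/-- For an analytic field, `z ↦ F (actE g z) k` is analytic on the ball. -/
theorem analyticAt_comp_actE {F : (Fin p → ℂ) → (Fin p → ℂ)} (hF : AnalyticOnNhd ℂ F (ballSet p))
    (g : U p) (k : Fin p) {z : Fin p → ℂ} (hz : z ∈ ballSet p) :
    AnalyticAt ℂ (fun z => F (actE g z) k) z :=
  (analyticAt_coord k _).comp ((hF _ (actE_mem_ballSet g hz)).comp (analyticAt_actE_fun g hz))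

/-- The entries of the translate: `(γ^*F)(z)_i = Σ_k J_γ(z)_{k i} F(γ z)_k`. -/
theorem pullE_apply (γ : U p) (F : (Fin p → ℂ) → (Fin p → ℂ)) (z : Fin p → ℂ) (i : Fin p) :
    pullE γ F z i = ∑ k, JacE γ z k i * F (actE γ z) k := by
  simp [pullE, Matrix.mulVec, dotProduct, Matrix.transpose_apply]

/-- The entries of the translate of an analytic field are analytic on the ball. -/
theorem analyticAt_pullE {F : (Fin p → ℂ) → (Fin p → ℂ)} (hF : AnalyticOnNhd ℂ F (ballSet p))
    (γ : U p) (i : Fin p) {z : Fin p → ℂ} (hz : z ∈ ballSet p) :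
    AnalyticAt ℂ (fun z => pullE γ F z i) z := by
  have h : (fun z => pullE γ F z i) = fun z => ∑ k, JacE γ z k i * F (actE γ z) k :=
    funext fun z => pullE_apply γ F z i
  rw [h]
  exact Finset.analyticAt_fun_sum _ fun k _ =>
    (analyticAt_JacE γ k i hz).fun_mul (analyticAt_comp_actE hF γ k hz)

/-! ### The determinant of the translated covectors -/

/-- The matrix `((γ_i^*F_i)(z)_j)_{i j}` of `p` translated covectors at `z`. -/
def matE (γ : Fin p → U p) (F : Fin p → (Fin p → ℂ) → (Fin p → ℂ)) (z : Fin p → ℂ) :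
    Matrix (Fin p) (Fin p) ℂ :=
  Matrix.of fun i j => pullE (γ i) (F i) z j

/-- Its determinant, a function on `ℂ^p`. -/
def detE (γ : Fin p → U p) (F : Fin p → (Fin p → ℂ) → (Fin p → ℂ)) (z : Fin p → ℂ) : ℂ :=
  (matE γ F z).det

/-- The rows of a square matrix over `ℂ` are linearly independent iff its determinant is non-zero. -/
theorem linearIndependent_row_iff_det_ne_zero (M : Matrix (Fin p) (Fin p) ℂ) :
    LinearIndependent ℂ M.row ↔ M.det ≠ 0 := by
  rw [Matrix.linearIndependent_rows_iff_isUnit, Matrix.isUnit_iff_isUnit_det, isUnit_iff_ne_zero]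

/-- The rows of `matE` are the translated covectors (on the ball). -/
theorem matE_row (γ : Fin p → U p) (F : Fin p → (Fin p → ℂ) → (Fin p → ℂ)) (z : Ball p) :
    (matE γ F z.1).row = fun i => pullback (γ i) (fun w : Ball p => F i w.1) z := rfl

/-- **Independence ⟺ non-zero determinant.**  The translated covectors `(γ_i^*F_i)(z)` are linearly
independent iff `detE γ F z ≠ 0`. -/
theorem linearIndependent_iff_detE_ne_zero (γ : Fin p → U p) (F : Fin p → (Fin p → ℂ) → (Fin p → ℂ))
    (z : Ball p) :
    LinearIndependent ℂ (fun i => pullback (γ i) (fun w : Ball p => F i w.1) z) ↔ detE γ F z.1 ≠ 0 :=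
  linearIndependent_row_iff_det_ne_zero (matE γ F z.1)

/-- The determinant of the translated covectors of analytic fields is analytic on the ball. -/
theorem analyticOnNhd_detE {F : Fin p → (Fin p → ℂ) → (Fin p → ℂ)}
    (hF : ∀ i, AnalyticOnNhd ℂ (F i) (ballSet p)) (γ : Fin p → U p) :
    AnalyticOnNhd ℂ (detE γ F) (ballSet p) := by
  intro z hz
  have h : detE γ F = fun z => ∑ σ : Equiv.Perm (Fin p),
      Equiv.Perm.sign σ * ∏ i, pullE (γ (σ i)) (F (σ i)) z i := by
    funext z
    simp only [detE, Matrix.det_apply', matE, Matrix.of_apply]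
  rw [h]
  exact Finset.analyticAt_fun_sum _ fun σ _ =>
    analyticAt_const.fun_mul (Finset.analyticAt_fun_prod _ fun i _ => analyticAt_pullE (hF _) _ i hz)

/-! ### Generic independence -/

/-- **Generic independence.**  For `ℂ`-analytic fields `F₁, …, F_p` on the ball and translates `γ_i`: if the
translated covectors are linearly independent at ONE point, they are linearly independent on a DENSE subset of
the ball (the determinant is analytic on the connected ball; if it vanished on a non-empty open set it would
vanish identically). -/
theorem dense_linearIndependent_of_analyticOnNhd {F : Fin p → (Fin p → ℂ) → (Fin p → ℂ)}
    (hF : ∀ i, AnalyticOnNhd ℂ (F i) (ballSet p)) (γ : Fin p → U p)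
    (h : ∃ z : Ball p, LinearIndependent ℂ fun i => pullback (γ i) (fun w : Ball p => F i w.1) z) :
    Dense {z : Ball p | LinearIndependent ℂ fun i => pullback (γ i) (fun w : Ball p => F i w.1) z} := by
  have hd : AnalyticOnNhd ℂ (detE γ F) (ballSet p) := analyticOnNhd_detE hF γ
  rw [dense_iff_inter_open]
  intro V hV hVne
  by_contra hempty
  rw [Set.not_nonempty_iff_eq_empty] at hempty
  have hzero : ∀ z ∈ V, detE γ F z.1 = 0 := by
    intro z hz
    by_contra hne
    have hmem : z ∈ V ∩ {z : Ball p | LinearIndependent ℂ fun i =>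
        pullback (γ i) (fun w : Ball p => F i w.1) z} :=
      ⟨hz, by rw [Set.mem_setOf_eq, linearIndependent_iff_detE_ne_zero]; exact hne⟩
    rw [hempty] at hmem
    exact hmem
  obtain ⟨z₁, hz₁⟩ := hVne
  have hind : Topology.IsInducing (Subtype.val : Ball p → (Fin p → ℂ)) := Topology.IsInducing.subtypeVal
  obtain ⟨V', hV'o, hV'eq⟩ := hind.isOpen_iff.mp hV
  have hev : detE γ F =ᶠ[nhds z₁.1] 0 := by
    have hopen : IsOpen (V' ∩ ballSet p) := hV'o.inter isOpen_ballSet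
    have hmem : z₁.1 ∈ V' ∩ ballSet p := ⟨by rw [← hV'eq] at hz₁; exact hz₁, z₁.2⟩
    refine Filter.eventually_of_mem (hopen.mem_nhds hmem) ?_
    intro z hz
    have hzV : (⟨z, hz.2⟩ : Ball p) ∈ V := by rw [← hV'eq]; exact hz.1
    show detE γ F z = 0
    exact hzero ⟨z, hz.2⟩ hzV
  have hall : Set.EqOn (detE γ F) 0 (ballSet p) :=
    hd.eqOn_zero_of_preconnected_of_eventuallyEq_zero isPreconnected_ballSet z₁.2 hev
  obtain ⟨z, hz⟩ := h
  rw [linearIndependent_iff_detE_ne_zero] at hz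
  exact hz (hall z.2)

/-- The restriction of an analytic field to the ball is continuous. -/
theorem continuous_restrict {F : (Fin p → ℂ) → (Fin p → ℂ)} (hF : AnalyticOnNhd ℂ F (ballSet p)) :
    Continuous fun z : Ball p => F z.1 :=
  hF.continuousOn.comp_continuous continuous_ball_val val_mem_ballSet

/-- For continuous fields and fixed translates, `z ↦ det ((γ_i^*ω_i)(z))` is continuous on the ball. -/
theorem continuous_det_pullback {ω : Fin p → Ball p → Fin p → ℂ} (hω : ∀ i, Continuous (ω i))
    (γ : Fin p → U p) :
    Continuous fun z : Ball p => (Matrix.of fun i j => pullback (γ i) (ω i) z j).det := by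
  refine Continuous.matrix_det ?_
  refine continuous_matrix fun i j => ?_
  have hi : Continuous fun z : Ball p => pullback (γ i) (ω i) z :=
    Continuous.comp (f := fun z : Ball p => (γ i, z)) (g := fun q : U p × Ball p => pullback q.1 (ω i) q.2)
      (continuous_pullback (hω i)) (continuous_const.prodMk continuous_id)
  exact (continuous_apply j).comp hi

/-- For continuous fields the set of points where the translated covectors are independent is open. -/
theorem isOpen_linearIndependent {ω : Fin p → Ball p → Fin p → ℂ} (hω : ∀ i, Continuous (ω i))
    (γ : Fin p → U p) :
    IsOpen {z : Ball p | LinearIndependent ℂ fun i => pullback (γ i) (ω i) z} := by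
  have h : {z : Ball p | LinearIndependent ℂ fun i => pullback (γ i) (ω i) z} =
      {z : Ball p | (Matrix.of fun i j => pullback (γ i) (ω i) z j).det ≠ 0} := by
    ext z
    exact linearIndependent_row_iff_det_ne_zero (Matrix.of fun i j => pullback (γ i) (ω i) z j)
  rw [h]
  exact isOpen_ne_fun (continuous_det_pullback hω γ) continuous_const

/-- **Lemma W, generic form, every `p`.**  For a dense subgroup `Δ ≤ U(p,1)` and `ℂ`-analytic fields
`F₁, …, F_p` on the ball, none identically zero there, some `γ₁, …, γ_p ∈ Δ` make the translated covectors
`(γ_i^*F_i)(z)` linearly independent on an OPEN DENSE set of `z ∈ 𝔹^p` — `γ₁^*F₁ ∧ ⋯ ∧ γ_p^*F_p` is a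
holomorphic `p`-form vanishing only on a nowhere dense closed set. -/
theorem lemmaW_generic {Δ : Subgroup (U p)} (hΔ : Dense (Δ : Set (U p)))
    {F : Fin p → (Fin p → ℂ) → (Fin p → ℂ)} (hF : ∀ i, AnalyticOnNhd ℂ (F i) (ballSet p))
    (hF0 : ∀ i, ∃ w : Ball p, F i w.1 ≠ 0) :
    ∃ γ : Fin p → U p, (∀ i, γ i ∈ Δ) ∧
      IsOpen {z : Ball p | LinearIndependent ℂ fun i => pullback (γ i) (fun w : Ball p => F i w.1) z} ∧
      Dense {z : Ball p | LinearIndependent ℂ fun i => pullback (γ i) (fun w : Ball p => F i w.1) z} := by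
  obtain ⟨γ, hγΔ, z, hz⟩ := lemmaW_iter hΔ p le_rfl (fun i w => F i w.1) (fun i => continuous_restrict (hF i))
    hF0
  exact ⟨γ, hγΔ, isOpen_linearIndependent (fun i => continuous_restrict (hF i)) γ,
    dense_linearIndependent_of_analyticOnNhd hF γ ⟨z, hz⟩⟩

end Holo

end HodgeRepro.BallGen

end
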